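import Summits.BirchSwinnertonDyer.Rank1Residual.X5.TwoAdicInstancesT42AnchorsB
import Summits.BirchSwinnertonDyer.Rank1Residual.X5.TwoAdicInstancesMultAnchorsS
import Summits.BirchSwinnertonDyer.Rank1Residual.X5.TwoAdicInstances144027d
import Summits.BirchSwinnertonDyer.Rank1Residual.X5.TwoAdicInstancesToolkitC
import Summits.BirchSwinnertonDyer.Rank1Residual.X5.TwoAdicInstancesToolkitD
import HarnessLib

/-!
# X5 at `p = 2` (cell `bsd-2adic`, seat `bsd-2adic-t42`, GEN 7): NON-SPLIT ANCHORS `1442d2` for DOOR (34-GV-mult) — curve data only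

HONEST FRAMING (cell `bsd-2adic`, run/shared/lean/pub/bsd-2adic/, HUMAN RULINGS D-0036 / D-0054): research route; NO door theorem,
nothing displayed, nothing booked; BSD is not proved by any of this. PARTITION: X5@2 multiplicative (K4ᵐ, RESIDUAL-MAP B1·O1;
tranche 1 of the GV-mult habitat) × p = 2 — types-the-object-of (anchor curves for the congruence transport; closes none).
WHAT: the non-split multiplicative ANCHORS (`2 ∥ N`, `r = 1` (RANK-AWARE: `λ(X_A) = m` is pinned in the class files by K11 + Greenberg Thm. 1.9 from a displayed `hrankA`), exactly one rational `2`-torsion point, of Greenberg type A or B) that the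
tranche-1 classes of HOME/t42/DESIGN-T42-ADDENDUM-8.md need and that are NOT in the mult lane's anchors files
`X5/TwoAdicInstancesMultAnchors{A,B,C,S}.lean` (one writer per object: those files are imported elsewhere, never edited; planner word
2026-08-27T03:25:10Z (A) «if a class needs a NEW anchor, add it in a t42 anchors file»). Per anchor, DECIDED BY THE KERNEL: minimality,
ellipticity, NON-SPLIT multiplicative reduction at `2`, the conductor (squarefree: coprimality; additive `3`: Rizzo's Table II in the kernel;
additive `ℓ ≥ 5`: `f = 2`), the unique rational `2`-torsion point and its Greenberg type, `2 ∣ #Ẽ(𝔽_ℓ)` at good odd `ℓ`. The anchors'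
λ-invariant enters the doors ONLY through the displayed binders `hlanA : λ_an(A) = m`, `hμanA`, `hrankA` of the class files (rows:
engine-1 kit j270043 (the mult lane's GVM-law.gp = msfromell engine of kit j244761/j246440, VERBATIM: (0,2) STABLE, C0 EXACT, LAW PASS, MU0 YES; the twisted-L engine GVM-cert.gp is numerically unreliable at a rank-1 NON-SPLIT curve, kit j269518 row discarded) + engine-2 kit j269323 (afe2 v2: (0,2) OK STABLE) — two-engine, t42 GEN 7) — EVIDENCE, never facts. Emitter: HOME/t42/gen/gen_anchorsfile.py + memberdata.py (port of the mult lane's genlaw5.py member block).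
WHAT THIS IS NOT: not a door, not a certificate, not a discharge of anything.

References: [SilvermanAEC2009] VII.1, VII.3.1, VII.5.1, III.1–III.2; [Silverman1994] IV.10.2; [GreenbergLNM1716] §5, Prop. 5.14;
[GreenbergVatsal2000] p. 4 (anchors); [CremonaAlgorithms1997] Table 1 (1442d2); [Rizzo2003] Table II.
-/

set_option autoImplicit false

open IsDedekindDomain WeierstrassCurve Literature.NumberTheory.EllipticCurves
  Literature.NumberTheory.EllipticCurves.ModularForms
  Literature.NumberTheory.EllipticCurves.Rank1Residual
  Literature.NumberTheory.EllipticCurves.Rank1Residual.Typed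
  Literature.NumberTheory.EllipticCurves.Greenberg1999
  Literature.NumberTheory.EllipticCurves.PolyCert
  Literature.NumberTheory.EllipticCurves.Rank1Residual.X11RankOneCertificates
  Summit.BirchSwinnertonDyer.Rank1Residual.X1.MuPart
  Summit.BirchSwinnertonDyer.Rank1Residual.X1.ParitySqueeze
  Summit.BirchSwinnertonDyer.Rank1Residual.X5.O1

open CongruenceSubgroup
open scoped MatrixGroups ModularForm

namespace Summit.BirchSwinnertonDyer.Rank1Residual.X5.Instances

/-! ## Anchor `1442d2` (`N = 1442`, non-split at `2`, type A, `x(P) = 39/4`) -/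

/-- Cremona `1442d2` = `[1, 0, 1, -297, 1940]` (integer model). [cite: CremonaAlgorithms1997, Table 1] -/
abbrev M1442d2 : WeierstrassCurve ℤ := ⟨1, 0, 1, -297, 1940⟩
/-- `1442d2 / ℚ`. [cite: CremonaAlgorithms1997, Table 1] -/
abbrev c1442d2 : WeierstrassCurve ℚ := M1442d2.baseChange ℚ
/-- `Δ(1442d2) = 2^3·7·103^2`. [cite: CremonaAlgorithms1997, Table 1] -/
theorem M1442d2_Δ : M1442d2.Δ = 594104 := by decide
/-- `c₄(1442d2)` (`|c₄| = 43·331`). [cite: CremonaAlgorithms1997, Table 1] -/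
theorem M1442d2_c₄ : M1442d2.c₄ = 14233 := by decide
/-- `1442d2` is an elliptic curve. [cite: CremonaAlgorithms1997, Table 1] -/
instance c1442d2_isElliptic : c1442d2.IsElliptic := by
  rw [WeierstrassCurve.isElliptic_iff, baseChange_int_Δ, M1442d2_Δ]; norm_num
/-- Cremona's model `1442d2` is globally minimal (`gcd(Δ, c₄) = 1`). [cite: SilvermanAEC2009, VII.1 Remark 1.1] -/
instance c1442d2_isGloballyMinimal : c1442d2.IsGloballyMinimal :=
  isGloballyMinimal_baseChange_int_of_gcd_eq_one 1 0 1 (-297) 1940 (by decide)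
/-- **`1442d2` is multiplicative at `2`** (`2 ∣ Δ`, `2 ∤ c₄`). [cite: SilvermanAEC2009, VII.5 Prop. 5.1(b)] -/
theorem mult_two_1442d2 : Mult c1442d2 2 := by
  have hgen : Rat.HeightOneSpectrum.natGenerator
      ((Rat.HeightOneSpectrum.primesEquiv (R := ℤ)).symm ⟨2, Nat.prime_two⟩) = 2 :=
    Literature.NumberTheory.EllipticCurves.Rat.natGenerator_primesEquiv_symm ⟨2, Nat.prime_two⟩
  have hm : c1442d2.HasMultiplicativeReductionAt
      ((Rat.HeightOneSpectrum.primesEquiv (R := ℤ)).symm ⟨2, Nat.prime_two⟩) := by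
    refine hasMultiplicativeReductionAt_of_valuation_c₄_eq_one (isIntegralAt_baseChange _ M1442d2) ?_ ?_
    · rw [baseChange_int_c₄, Literature.NumberTheory.EllipticCurves.Rat.valuation_intCast_eq_one_iff, hgen,
        M1442d2_c₄]; decide
    · rw [baseChange_int_Δ, Literature.NumberTheory.EllipticCurves.Rat.valuation_intCast_lt_one_iff, hgen,
        M1442d2_Δ]; decide
  exact (hasMultiplicativeReductionAtPrime_iff_hasMultiplicativeReductionAt_holds c1442d2
    ⟨2, Nat.prime_two⟩).mpr hm
/-- `1442d2 mod 2`. [folklore] -/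
theorem M1442d2_mod_two : M1442d2.map (Int.castRingHom (ZMod 2)) = ⟨1, 0, 1, 1, 0⟩ := by
  ext <;> decide
/-- **`1442d2` is NON-SPLIT multiplicative at `2`** (the node quadratic `X² + X + 1` has no root in `𝔽₂`). [cite: SilvermanAEC2009, VII.5 Prop. 5.1(b)] -/
theorem not_split_two_1442d2 : ¬ c1442d2.HasSplitMultiplicativeReductionAtPrime 2 := by
  have hint : integralModelInt c1442d2 = M1442d2 := integralModelInt_baseChange_int M1442d2
  have hΔ : ((2 : ℕ) : ℤ) ∣ (integralModelInt c1442d2).Δ := by rw [hint, M1442d2_Δ]; decide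
  have hc₄ : ¬ ((2 : ℕ) : ℤ) ∣ (integralModelInt c1442d2).c₄ := by rw [hint, M1442d2_c₄]; decide
  rw [LocalTorsionMult.hasSplitMultiplicativeReductionAtPrime_iff_splits_integralModelInt c1442d2 2 hΔ
    hc₄, hint, M1442d2_mod_two]
  dsimp only
  rw [sub_eq_add_neg, ← Polynomial.C_neg]
  exact not_splits_quadratic_F2 (by decide) (by decide) (by decide)
/-- `Δ(1442d2)`, `c₄(1442d2)` coprime (semistable model). [cite: SilvermanAEC2009, VII.5 Prop. 5.1(b)] -/
theorem M1442d2_coprime : IsCoprime M1442d2.Δ M1442d2.c₄ := by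
  rw [M1442d2_Δ, M1442d2_c₄, Int.isCoprime_iff_gcd_eq_one]; decide
/-- **The conductor of `1442d2` is `1442`** (semistable: the radical of `Δ`; Silverman ATAEC IV.10.2). [cite: CremonaAlgorithms1997, Table 1] [cite: Silverman1994, IV.10.2] -/
theorem conductorNorm_1442d2 : c1442d2.conductorNorm ℤ = 1442 := by
  refine conductorNorm_baseChange_int_of_isCoprime M1442d2 M1442d2_coprime (k := 3) ?_ ?_ ?_
  · rw [Nat.squarefree_iff_nodup_primeFactorsList (by norm_num)]; simp
  · rw [M1442d2_Δ]; decide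
  · rw [M1442d2_Δ]; decide

/-- The coefficients of `1442d2 / ℚ` (unfolded). [cite: CremonaAlgorithms1997, Table 1] -/
theorem c1442d2_eq : c1442d2 = ⟨1, 0, 1, -297, 1940⟩ := by
  rw [c1442d2, baseChange_int_eq]; norm_num
/-- `b₂, b₄, b₆` of `1442d2`; `2`-division cubic `= (x − (39 / 4))(4x² + (40)x + ((-796)))`. [cite: SilvermanAEC2009, III.1] -/
theorem c1442d2_b : c1442d2.b₂ = 1 ∧ c1442d2.b₄ = -593 ∧ c1442d2.b₆ = 7761 := by
  rw [c1442d2_eq]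
  simp only [WeierstrassCurve.b₂, WeierstrassCurve.b₄, WeierstrassCurve.b₆]
  norm_num
/-- The rational point `(39/4, -43/8)` of order `2` on `1442d2`. [cite: CremonaAlgorithms1997, Table 1] -/
theorem c1442d2_P : c1442d2.toAffine.Equation (39 / 4) (-43 / 8) ∧
    2 * ((-43 / 8) : ℚ) + c1442d2.a₁ * (39 / 4) + c1442d2.a₃ = 0 := by
  rw [c1442d2_eq, WeierstrassCurve.Affine.equation_iff]; norm_num
/-- **`(39/4, -43/8)` is the ONLY rational point of order `2` on `1442d2`** (the cofactor `4x² + (40)x + ((-796))` has non-square discriminant). [cite: SilvermanAEC2009, III.2.3] -/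
theorem c1442d2_unique : HasUniqueRationalTwoTorsionX c1442d2 (39 / 4) := by
  refine ⟨⟨(-43 / 8), c1442d2_P⟩, fun z hz ↦ ?_⟩
  have hc := cubic_eq_zero_of_hasRationalTwoTorsionX hz
  obtain ⟨hb₂, hb₄, hb₆⟩ := c1442d2_b
  rw [hb₂, hb₄, hb₆] at hc
  have hfac : (z - (39 / 4)) * (4 * z ^ 2 + 40 * z + (-796)) = 0 := by linear_combination hc
  exact eq_of_cubic_factor_of_not_isSquare z hfac (by norm_num)
/-- `(39/4, ·)` is NOT "odd": `(−u − √(u² − 16v))/8 < 39/4` is a smaller real root of the `2`-division cubic (`u = 40`, `v = -796`).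
[cite: GreenbergLNM1716, §5 Remark (chunk p0174)] -/
theorem c1442d2_not_odd : ¬ TwoTorsionOdd c1442d2 (39 / 4) := by
  intro hodd
  obtain ⟨hb₂, hb₄, hb₆⟩ := c1442d2_b
  obtain ⟨r, hr, hlt⟩ := exists_cubic_root_lt (x₀ := ((39 / 4) : ℝ)) (u := 40) (v := (-796)) (by norm_num)
    (lt_of_lt_of_le (by norm_num) (Real.sqrt_nonneg _))
  have := hodd r (by rw [hb₂, hb₄, hb₆]; push_cast; linear_combination hr)
  push_cast at this
  linarith
/-- **`(39/4, ·)` is of Greenberg type A** (ramified at `2`, not odd). [cite: GreenbergLNM1716, Prop. 5.14 (p. 171)] -/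
theorem c1442d2_typeAB : (TwoTorsionRamifiedAtTwo ((39 / 4) : ℚ) ∧ ¬ TwoTorsionOdd c1442d2 (39 / 4)) ∨
    (TwoTorsionOdd c1442d2 (39 / 4) ∧ ¬ TwoTorsionRamifiedAtTwo ((39 / 4) : ℚ)) :=
  Or.inl ⟨c30a5_ram, c1442d2_not_odd⟩

/-- `2 ∣ #Ẽ(𝔽_ℓ)` for `1442d2` at every good odd prime `ℓ` (a rational `2`-torsion point). [cite: SilvermanAEC2009, VII.3.1(b)] -/
theorem two_dvd_reductionPointCount_1442d2 {ℓ : ℕ} [Fact ℓ.Prime] (hℓ : 3 ≤ ℓ)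
    (hΔ : ¬ (ℓ : ℤ) ∣ (594104 : ℤ)) : 2 ∣ c1442d2.reductionPointCount ℓ :=
  two_dvd_reductionPointCount_of_hasRationalTwoTorsionX ⟨(-43 / 8), c1442d2_P⟩ hℓ
    (by rw [minimalDiscriminantInt_baseChange_int, M1442d2_Δ]; exact hΔ)

end Summit.BirchSwinnertonDyer.Rank1Residual.X5.Instances
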